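import Literature.AlgebraicGeometry.Morphisms.CechModuleFiniteSupport
import Mathlib.RingTheory.Length
import HarnessLib

/-!
# Global sections of a sheaf supported on finitely many closed points: `Γ(X, M) = ⊕_p Γ(U_p, M)`

Sequel of `Morphisms/CechModuleFiniteSupport.lean`.  For a scheme `f : X → Spec A`, a sheaf of
`𝒪_X`-modules `M` and a FINITE set `S` of CLOSED points such that `M` is supported on `S` (its sections
over every open disjoint from `S` vanish), and opens `U_p ∋ p` (`p ∈ S`) containing no other point of `S`:
restriction is an `A`-linear bijection

  `Γ(X, M) ⥲ Π_{p ∈ S} Γ(U_p, M)`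

(R. Hartshorne, *Algebraic Geometry*, II Ex. 1.17 / Ex. 1.19–1.20: a sheaf supported on a discrete closed
set is the direct sum of the skyscrapers `i_{p*}(M_p)`, and `Γ(X, i_{p*}M_p) = M_p = Γ(U_p, M)` for `U_p`
meeting the support only in `p`; Godement II 4.4).  Hence for `A`-lengths
`ℓ_A Γ(X, M) = Σ_{p ∈ S} ℓ_A Γ(U_p, M)` — the additivity over the points that turns the `h⁰`-length of a
zero-dimensional closed subscheme `V(𝓘) ⊆ X` into a sum of local lengths (J. Lipman, Publ. Math. IHÉS 36
(1969), §10 p. 212 and §13 p. 223: `h⁰(𝒪_{E∩F}) = Σ_w [κ(w):κ] ℓ(𝒪_{X,w}/(𝓘_E+𝓘_F)_w)`).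

* `MSections.pi_res_injective_of_finite_support`, `MSections.pi_res_surjective_of_finite_support` —
  `s ↦ (s|_{U_p})_p` is bijective (locality / gluing along the cover `{U_p} ∪ {X ∖ S}`, on whose
  overlaps `M` has no non-zero sections);
* `MSections.length_top_eq_sum_of_finite_support` — `ℓ_A Γ(X, M) = Σ_p ℓ_A Γ(U_p, M)`.

Everything is proved; no named facts, no definitions.

## References
* R. Hartshorne, *Algebraic Geometry*, GTM 52 (1977): II Ex. 1.17, Ex. 1.19–1.20, II §1 sheaf axioms
  (3)–(4) (p. 61). [Hartshorne1977]
* J. Lipman, Publ. Math. IHÉS 36 (1969), §10 (p. 212), §13 (p. 223). [Lipman1969]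
-/

noncomputable section

open CategoryTheory AlgebraicGeometry TopologicalSpace Opposite

universe u

namespace Literature.AlgebraicGeometry.Morphisms

namespace MSections

variable {A : Type u} [CommRing A] {X : Scheme.{u}} (f : X ⟶ Spec (.of A)) (M : X.Modules)
  {S : Set X} (hS : S.Finite) (hT1 : ∀ p ∈ S, IsClosed ({p} : Set X))
  (hsupp : ∀ W : X.Opens, Disjoint (W : Set X) S → ∀ s : MSections f M W, s = 0)
  (U : X → X.Opens) (hU : ∀ p ∈ S, p ∈ U p) (hU' : ∀ p ∈ S, ∀ q ∈ S, q ∈ U p → q = p)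

/-- A finite set of closed points is closed. [folklore] -/
private theorem isClosed_of_finite' (hS : S.Finite) (hT1 : ∀ p ∈ S, IsClosed ({p} : Set X)) :
    IsClosed S := by
  have h := hS.isClosed_biUnion hT1
  rwa [Set.biUnion_of_singleton] at h

include hU in
/-- The opens `U_p`, `p ∈ S`, together with the complement `X ∖ S` (index `none`), cover `X`. [folklore] -/
private theorem le_iSup_cover (hSc : IsClosed S) :
    (⊤ : X.Opens) ≤ ⨆ j : Option S, j.elim (⟨Sᶜ, hSc.isOpen_compl⟩ : X.Opens) fun p => U p.1 := by
  intro x _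
  by_cases hx : x ∈ S
  · exact Opens.mem_iSup.mpr ⟨some ⟨x, hx⟩, hU x hx⟩
  · exact Opens.mem_iSup.mpr ⟨none, hx⟩

include hU' in
/-- Two distinct members of the cover `{U_p} ∪ {X ∖ S}` meet `S` in no point. [folklore] -/
private theorem disjoint_cover_inf (hSc : IsClosed S) {j j' : Option S} (hjj' : j ≠ j') :
    Disjoint (((j.elim (⟨Sᶜ, hSc.isOpen_compl⟩ : X.Opens) fun p => U p.1) ⊓
      (j'.elim (⟨Sᶜ, hSc.isOpen_compl⟩ : X.Opens) fun p => U p.1) : X.Opens) : Set X) S := by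
  rw [Set.disjoint_left]
  rintro x ⟨hxj, hxj'⟩ hxS
  cases j with
  | none => exact (show x ∈ Sᶜ from hxj) hxS
  | some p =>
    cases j' with
    | none => exact (show x ∈ Sᶜ from hxj') hxS
    | some q =>
      apply hjj'
      have h1 : x = p.1 := hU' p.1 p.2 x hxS hxj
      have h2 : x = q.1 := hU' q.1 q.2 x hxS hxj'
      rw [Option.some.injEq]
      exact Subtype.ext (h1.symm.trans h2)

include hT1 hsupp hU in
/-- **`Γ(X, M) → Π_{p ∈ S} Γ(U_p, M)` is injective** for `M` supported on the finite set `S` of closed points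
and opens `U_p ∋ p` meeting `S` only in `p` (locality along `{U_p} ∪ {X ∖ S}`).
[cite: Hartshorne1977, II Ex. 1.17 and Ex. 1.20] -/
theorem pi_res_injective_of_finite_support (hS : S.Finite) :
    Function.Injective (LinearMap.pi fun p : S => res f M (le_top : U p.1 ≤ ⊤)) := by
  have hSc := isClosed_of_finite' hS hT1
  intro s t hst
  refine eq_of_res_eq f M (fun j : Option S => j.elim (⟨Sᶜ, hSc.isOpen_compl⟩ : X.Opens) fun p => U p.1)
    (fun _ => le_top) (le_iSup_cover U hU hSc) fun j => ?_
  cases j with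
  | none =>
    have hd : Disjoint (((none : Option S).elim (⟨Sᶜ, hSc.isOpen_compl⟩ : X.Opens) fun p => U p.1 :
        X.Opens) : Set X) S :=
      Set.disjoint_left.mpr fun x (hx : x ∈ Sᶜ) hxS => hx hxS
    rw [hsupp _ hd (res f M _ s), hsupp _ hd (res f M _ t)]
  | some p => exact congrFun hst p

include hT1 hsupp hU hU' in
/-- **`Γ(X, M) → Π_{p ∈ S} Γ(U_p, M)` is surjective** for `M` supported on the finite set `S` of closed points
and opens `U_p ∋ p` meeting `S` only in `p`: local sections `s_p ∈ Γ(U_p, M)` glue with `0` on `X ∖ S`, the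
overlaps carrying no non-zero section. [cite: Hartshorne1977, II Ex. 1.17 and Ex. 1.19] -/
theorem pi_res_surjective_of_finite_support (hS : S.Finite) :
    Function.Surjective (LinearMap.pi fun p : S => res f M (le_top : U p.1 ≤ ⊤)) := by
  have hSc := isClosed_of_finite' hS hT1
  intro s
  -- the family of local sections: `s_p` on `U_p`, `0` on `X ∖ S`
  let W : Option S → X.Opens := fun j => j.elim (⟨Sᶜ, hSc.isOpen_compl⟩ : X.Opens) fun p => U p.1
  let σ : ∀ j : Option S, MSections f M (W j) := fun j =>
    match j with
    | none => 0
    | some p => s p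
  obtain ⟨t, ht⟩ := exists_res_eq f M W (fun _ => le_top) (le_iSup_cover U hU hSc) σ
    (fun j j' => by
      by_cases hjj' : j = j'
      · subst hjj'
        rfl
      · rw [hsupp _ (disjoint_cover_inf U hU' hSc hjj') (res f M _ (σ j)),
          hsupp _ (disjoint_cover_inf U hU' hSc hjj') (res f M _ (σ j'))])
  exact ⟨t, funext fun p => ht (some p)⟩

include hT1 hsupp hU hU' in
/-- **`ℓ_A Γ(X, M) = Σ_{p ∈ S} ℓ_A Γ(U_p, M)`** for `M` supported on the finite set `S` of closed points and
opens `U_p ∋ p` meeting `S` only in `p` (`Γ(X, M) ≅ Π_p Γ(U_p, M)`). This is the additivity over the points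
of the support by which `h⁰` of a zero-dimensional subscheme is a sum of local lengths (Lipman, §10, §13).
[cite: Hartshorne1977, II Ex. 1.17] [cite: Lipman1969, Section 13 (p. 223)] -/
theorem length_top_eq_sum_of_finite_support (hS : S.Finite) :
    haveI := hS.fintype
    Module.length A (MSections f M ⊤) = ∑ p : S, Module.length A (MSections f M (U p.1)) := by
  haveI := hS.fintype
  rw [← Module.length_pi_of_fintype]
  exact (LinearEquiv.ofBijective _ ⟨pi_res_injective_of_finite_support f M hT1 hsupp U hU hS,
    pi_res_surjective_of_finite_support f M hT1 hsupp U hU hU' hS⟩).length_eq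

end MSections

end Literature.AlgebraicGeometry.Morphisms

end
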